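import Mathlib
import Summits.ResolutionOfSingularities.ResolutionOfSingularities.Theorems.WeightedInvariantLocalWeightedDropWildPurePowerFlagDefs

/-!
# `WeightedInvariant.LocalWeightedDrop`, line `hasse-ridge-face-selection`, piece S3πM: basic facts on the game-side flag invariant —
# supports, the exceptional monomial, the residual order, and "`d_res = 0` is the monomial case"

Crux item stmt-ResolutionOfSingularities-8899 `LocalWeightedDrop` (route `ResolutionOfSingularities/WeightedInvariant`), serving the
door `WeightedConstruction` stmt-ResolutionOfSingularities-0571.  [OURS · L1 W4.3, chain w43, stub worker 1 (gen 3); bookkeeping for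
`PurePowerFlag` (`…WildPurePowerFlagDefs`); not a statement of any manuscript.]

* support lemmas for `ordAlong`, `initialPart`, `wOrder` (= `MvPowerSeries.weightedOrder`) on `k[[x,y]]`;
* `le_excExp_apply` / `excExp_le`: every monomial of `B` is divisible by the exceptional monomial `M = excExp B E`;
  `dRes_add_degree_excExp`: `d_res + deg M = ord B` ("`d_res = ord G = ord F − ord_{E_a} F`", [Hauser–Perlega, PRIMS 60 (2024) §4 p. 776]);
* `eq_monomial_mul_of_dRes_eq_zero`, `termSub_of_dRes_eq_zero`: "X is in the classical monomial case at a if and only if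
  d_res = 0" (p. 777 l. 2–3) — for a clean non-zero `B` with `d_res = 0`, `B = x^a y^b · U`, `U(0) ≠ 0`, `(a,b) ∉ q·ℕ²`, a literal
  terminal shape, so the state is terminal up to the trivial triangular change;
* `dRes_pos_of_not_termSub`: hence `d_res ≥ 1` at every clean non-terminal position.
-/

set_option linter.dupNamespace false -- mandated namespace of this single-conjunct summit

namespace Summit.ResolutionOfSingularities.ResolutionOfSingularities.Theorems

open Literature.AlgebraicGeometry.Resolution
open Literature.AlgebraicGeometry.Resolution.HauserPerlega2024

namespace PurePowerFlag

open MvPowerSeries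

variable {k : Type} [Field k]

/-! ### `ordAlong`, `initialPart`, `wOrder` -/

/-- A monomial in the support bounds the order along a letter. -/
theorem ordAlong_le {σ : Type*} (y : σ) {H : MvPowerSeries σ k} {d : σ →₀ ℕ} (hd : coeff d H ≠ 0) :
    ordAlong y H ≤ (d y : ℕ∞) :=
  iInf₂_le d hd

/-- A lower bound on all `y`-exponents of the support bounds the order along `y` from below. -/
theorem le_ordAlong {σ : Type*} (y : σ) {H : MvPowerSeries σ k} {c : ℕ∞} (h : ∀ d : σ →₀ ℕ, coeff d H ≠ 0 → c ≤ d y) :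
    c ≤ ordAlong y H :=
  le_iInf₂ h

/-- The order along a letter of a non-zero series is attained on the support. -/
theorem exists_coeff_ne_zero_ordAlong {σ : Type*} (y : σ) {H : MvPowerSeries σ k} (hH : H ≠ 0) :
    ∃ d : σ →₀ ℕ, coeff d H ≠ 0 ∧ ordAlong y H = (d y : ℕ∞) := by
  classical
  have hne : ∃ d : σ →₀ ℕ, coeff d H ≠ 0 := by
    by_contra h
    push Not at h
    exact hH (MvPowerSeries.ext h)
  -- the infimum of a non-empty set of naturals (cast to `ℕ∞`) is attained
  have hSne : ({n | ∃ d : σ →₀ ℕ, coeff d H ≠ 0 ∧ d y = n} : Set ℕ).Nonempty := by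
    obtain ⟨d, hd⟩ := hne
    exact ⟨d y, Set.mem_setOf_eq ▸ ⟨d, hd, rfl⟩⟩
  obtain ⟨d, hd, hdy⟩ := Nat.sInf_mem hSne
  refine ⟨d, hd, le_antisymm (ordAlong_le y hd) (le_ordAlong y fun d' hd' => ?_)⟩
  rw [hdy]
  have hmem : d' y ∈ ({n | ∃ d : σ →₀ ℕ, coeff d H ≠ 0 ∧ d y = n} : Set ℕ) := ⟨d', hd', rfl⟩
  exact_mod_cast Nat.sInf_le hmem

/-- The order along a letter of a non-zero series is finite. -/
theorem ordAlong_ne_top {σ : Type*} (y : σ) {H : MvPowerSeries σ k} (hH : H ≠ 0) : ordAlong y H ≠ ⊤ := by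
  obtain ⟨d, -, hd⟩ := exists_coeff_ne_zero_ordAlong y hH
  rw [hd]
  exact ENat.coe_ne_top _

open Classical in
/-- Coefficients of the weighted initial part. -/
theorem coeff_initialPart {σ : Type*} (ω : σ → ℕ) (H : MvPowerSeries σ k) (d : σ →₀ ℕ) :
    coeff d (initialPart ω H) = if ((Finsupp.weight ω d : ℕ) : ℕ∞) = wOrder ω H then coeff d H else 0 := rfl

/-- `wOrder` is Mathlib's weighted order. -/
theorem wOrder_eq {σ : Type*} (ω : σ → ℕ) (H : MvPowerSeries σ k) : wOrder ω H = H.weightedOrder ω := rfl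

/-- A non-zero coefficient of the initial part is a coefficient of `H` on the weight line. -/
theorem coeff_initialPart_ne_zero_iff {σ : Type*} (ω : σ → ℕ) (H : MvPowerSeries σ k) (d : σ →₀ ℕ) :
    coeff d (initialPart ω H) ≠ 0 ↔ coeff d H ≠ 0 ∧ ((Finsupp.weight ω d : ℕ) : ℕ∞) = wOrder ω H := by
  rw [coeff_initialPart]
  split_ifs with h
  · exact ⟨fun hd => ⟨hd, h⟩, fun hd => hd.1⟩
  · exact ⟨fun hd => absurd rfl hd, fun hd => absurd hd.2 h⟩

/-! ### The order and the support in two letters -/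

/-- A non-zero plane series has a monomial of degree `ord`. -/
theorem exists_coeff_ne_zero_degree_eq_order {B : MvPowerSeries (Fin 2) k} (hB : B ≠ 0) :
    ∃ d : Fin 2 →₀ ℕ, coeff d B ≠ 0 ∧ d 0 + d 1 = B.order.toNat := by
  have hfin : B.order ≠ ⊤ := fun h => hB (order_eq_top_iff.mp h)
  obtain ⟨n, hn⟩ := ENat.ne_top_iff_exists.mp hfin
  obtain ⟨⟨d, hd, hdeg⟩, -⟩ := order_eq_nat.mp hn.symm
  refine ⟨d, hd, ?_⟩
  rw [← hn, ENat.toNat_coe, ← hdeg, Finsupp.degree_eq_sum, Fin.sum_univ_two]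

/-- Every monomial of a plane series has degree at least `ord`. -/
theorem order_toNat_le_degree {B : MvPowerSeries (Fin 2) k} {d : Fin 2 →₀ ℕ} (hd : coeff d B ≠ 0) :
    B.order.toNat ≤ d 0 + d 1 := by
  have h := order_le hd
  have hfin : B.order ≠ ⊤ := ne_top_of_le_ne_top (ENat.coe_ne_top _) h
  rw [← ENat.coe_toNat hfin] at h
  have h' : B.order.toNat ≤ Finsupp.degree d := by exact_mod_cast h
  rwa [Finsupp.degree_eq_sum, Fin.sum_univ_two] at h'

/-! ### The exceptional monomial and the residual order -/

/-- The exceptional exponent at a letter of `E`. -/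
theorem excExp_apply_of_mem {B : MvPowerSeries (Fin 2) k} {E : Finset (Fin 2)} {i : Fin 2} (hi : i ∈ E) :
    excExp B E i = (ordAlong i B).toNat := by
  unfold excExp
  rw [Finsupp.finsetSum_apply, Finset.sum_eq_single i]
  · rw [Finsupp.single_eq_same]
  · intro j _ hji; rw [Finsupp.single_apply, if_neg hji]
  · intro h; exact absurd hi h

/-- The exceptional exponent vanishes off `E`. -/
theorem excExp_apply_of_not_mem {B : MvPowerSeries (Fin 2) k} {E : Finset (Fin 2)} {i : Fin 2} (hi : i ∉ E) :
    excExp B E i = 0 := by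
  unfold excExp
  rw [Finsupp.finsetSum_apply, Finset.sum_eq_zero]
  intro j hj
  rw [Finsupp.single_apply, if_neg]
  rintro rfl
  exact hi hj

/-- EVERY MONOMIAL OF `B` IS DIVISIBLE BY THE EXCEPTIONAL MONOMIAL: `excExp B E ≤ d` for `d` in the support.
[HP24 §4 p. 776: "M … the unique monomial of maximal degree supported on E_a that divides F"] -/
theorem excExp_le {B : MvPowerSeries (Fin 2) k} (E : Finset (Fin 2)) {d : Fin 2 →₀ ℕ} (hd : coeff d B ≠ 0) :
    excExp B E ≤ d := by
  intro i
  by_cases hi : i ∈ E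
  · rw [excExp_apply_of_mem hi]
    have h := ordAlong_le i hd
    have hfin : ordAlong i B ≠ ⊤ := ne_top_of_le_ne_top (ENat.coe_ne_top _) h
    rw [← ENat.coe_toNat hfin] at h
    exact_mod_cast h
  · rw [excExp_apply_of_not_mem hi]; exact Nat.zero_le _

/-- The degree of the exceptional monomial is the sum appearing in `dRes`. -/
theorem degree_excExp (B : MvPowerSeries (Fin 2) k) (E : Finset (Fin 2)) :
    excExp B E 0 + excExp B E 1 = ∑ i ∈ E, (ordAlong i B).toNat := by
  have h : ∀ i : Fin 2, excExp B E i = if i ∈ E then (ordAlong i B).toNat else 0 := fun i => by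
    split_ifs with hi
    · exact excExp_apply_of_mem hi
    · exact excExp_apply_of_not_mem hi
  have hE : ∑ i ∈ E, (ordAlong i B).toNat = ∑ i : Fin 2, if i ∈ E then (ordAlong i B).toNat else 0 := by
    rw [← Finset.sum_filter]
    congr 1
    ext i
    simp
  rw [hE, Fin.sum_univ_two, h 0, h 1]

/-- "`d_res = ord F − ord_{E_a} F`": `d_res + deg M = ord B` for `B ≠ 0`. [HP24 §4 p. 776] -/
theorem dRes_add_degree_excExp {B : MvPowerSeries (Fin 2) k} (hB : B ≠ 0) (E : Finset (Fin 2)) :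
    dRes B E + (excExp B E 0 + excExp B E 1) = B.order.toNat := by
  obtain ⟨d, hd, hdeg⟩ := exists_coeff_ne_zero_degree_eq_order hB
  have hle := excExp_le E hd
  have h0 := hle 0
  have h1 := hle 1
  unfold dRes
  rw [← degree_excExp]
  omega

/-! ### `d_res = 0` is the monomial case -/

/-- For a CLEAN non-zero `B` with `d_res = 0`: `B = M · U` with `U(0) ≠ 0` and `M ∉ q·ℕ²`. [HP24 §4 p. 777 l. 2–3: "X is in the
classical monomial case at a if and only if d_res = 0"] -/
theorem eq_monomial_mul_of_dRes_eq_zero {q : ℕ} {B : MvPowerSeries (Fin 2) k} (E : Finset (Fin 2)) (hB : B ≠ 0)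
    (hclean : cleanSeries q B = B) (hd : dRes B E = 0) :
    B = X 0 ^ (excExp B E 0) * X 1 ^ (excExp B E 1) * divMonomial (excExp B E) B ∧
      constantCoeff (divMonomial (excExp B E) B) ≠ 0 ∧ ¬ (q ∣ excExp B E 0 ∧ q ∣ excExp B E 1) := by
  classical
  set M := excExp B E with hM
  obtain ⟨d, hdc, hdeg⟩ := exists_coeff_ne_zero_degree_eq_order hB
  have hsum := dRes_add_degree_excExp hB E
  rw [hd, zero_add, ← hM] at hsum
  -- the order-realising monomial IS the exceptional monomial
  have hdM : d = M := by
    have hle := excExp_le E hdc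
    rw [← hM] at hle
    have h0 := hle 0
    have h1 := hle 1
    ext i
    fin_cases i
    · show d 0 = M 0; omega
    · show d 1 = M 1; omega
  have hMc : coeff M B ≠ 0 := by rw [← hdM]; exact hdc
  have hM2 : Finsupp.single (0 : Fin 2) (M 0) + Finsupp.single 1 (M 1) = M := by
    ext i
    fin_cases i <;> simp
  have hXY : (X 0 : MvPowerSeries (Fin 2) k) ^ (M 0) * X 1 ^ (M 1) = monomial M 1 := by
    rw [X_pow_eq, X_pow_eq, monomial_mul_monomial, one_mul, hM2]
  refine ⟨?_, ?_, ?_⟩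
  · rw [hXY]
    ext n
    rw [coeff_monomial_mul]
    split_ifs with hle
    · rw [one_mul]
      show coeff n B = coeff (n - M + M) B
      rw [tsub_add_cancel_of_le hle]
    · by_contra hne
      exact hle (excExp_le E hne)
  · show coeff 0 (divMonomial M B) ≠ 0
    show coeff (0 + M) B ≠ 0
    rw [zero_add]; exact hMc
  · have h := (coeff_cleanSeries_of_ne_zero q B M (by rw [hclean]; exact hMc)).2
    intro hdvd
    apply h
    intro i
    fin_cases i
    · exact hdvd.1
    · exact hdvd.2

/-- The trivial triangular change is the identity: `expansion q B 0 = cleanSeries q B`. -/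
theorem expansion_zero (q : ℕ) (B : MvPowerSeries (Fin 2) k) : expansion q B 0 = cleanSeries q B := by
  unfold expansion
  rw [shift_eq, subst_shift_zero]

/-- `d_res = 0` at a clean non-zero position makes it TERMINAL up to the trivial triangular change. [HP24 §4 p. 777 l. 2–3] -/
theorem termSub_of_dRes_eq_zero {q : ℕ} {B : MvPowerSeries (Fin 2) k} (E : Finset (Fin 2)) (hB : B ≠ 0)
    (hclean : cleanSeries q B = B) (hd : dRes B E = 0) : TermSub q B := by
  obtain ⟨heq, hU, hndvd⟩ := eq_monomial_mul_of_dRes_eq_zero E hB hclean hd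
  refine ⟨false, 0, map_zero _, Or.inl ⟨excExp B E 0, excExp B E 1, divMonomial (excExp B E) B, hU, hndvd, ?_⟩⟩
  rw [orient_false, expansion_zero, hclean]
  exact heq

/-- At a clean, non-zero, non-terminal position the residual order is POSITIVE. [HP24 Prop. 3 p. 792 l. 41–44: "d = 0 … would imply
that d_res = 0 and that X is in the monomial case"] -/
theorem dRes_pos_of_not_termSub {q : ℕ} {B : MvPowerSeries (Fin 2) k} (E : Finset (Fin 2)) (hB : B ≠ 0)
    (hclean : cleanSeries q B = B) (hT : ¬ TermSub q B) : 0 < dRes B E := by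
  by_contra h
  exact hT (termSub_of_dRes_eq_zero E hB hclean (Nat.eq_zero_of_not_pos h))

/-! ### The letter swap on the basic quantities -/

/-- The support of the letter swap. -/
theorem coeff_swap_ne_zero_iff (B : MvPowerSeries (Fin 2) k) (d : Fin 2 →₀ ℕ) :
    coeff d (swap B) ≠ 0 ↔ coeff (Finsupp.equivMapDomain (Equiv.swap (0 : Fin 2) 1) d) B ≠ 0 := by
  rw [coeff_swap]

/-- The letter swap preserves the order. -/
theorem order_swap (B : MvPowerSeries (Fin 2) k) : (swap B).order = B.order := by
  have key : ∀ C : MvPowerSeries (Fin 2) k, C.order ≤ (swap C).order := by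
    intro C
    refine MvPowerSeries.le_order fun d hd => ?_
    rw [coeff_swap]
    apply coeff_of_lt_order
    refine lt_of_eq_of_lt ?_ hd
    congr 1
    rw [Finsupp.degree_eq_sum, Finsupp.degree_eq_sum, Fin.sum_univ_two, Fin.sum_univ_two]
    simp only [Finsupp.equivMapDomain_apply, Equiv.symm_swap, Equiv.swap_apply_left, Equiv.swap_apply_right]
    ring
  exact le_antisymm (by simpa only [swap_swap] using key (swap B)) (key B)

/-- The letter swap of a non-zero series is non-zero. -/
theorem swap_ne_zero {B : MvPowerSeries (Fin 2) k} (hB : B ≠ 0) : swap B ≠ 0 := by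
  intro h
  apply hB
  rw [← swap_swap B, h]
  exact map_zero _

end PurePowerFlag

end Summit.ResolutionOfSingularities.ResolutionOfSingularities.Theorems
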